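import Literature.AlgebraicGeometry.Frobenioids.GeometricFrobenioidModel
import Literature.AlgebraicGeometry.Frobenioids.GeometricDivisorDataWitness
import Mathlib.CategoryTheory.PEmpty
import HarnessLib

/-!
# Frobenioids I, Theorem 6.2 (i): the typed schema `Thm62i` over a FREE target model — kernel refutation
# of its universal closure (PROOF-ONLY companion)

Mochizuki, *The geometry of Frobenioids I: the general theory*, Kyushu J. Math. **62** (2008), Theorem 6.2 (i),
kurims text pp. 110–111: a dominant morphism `ψ : V₂ → V₁` satisfying (a)–(c) "induces a functor `Ψ : C₁ → C₂`
[well-defined up to isomorphism] that is compatible with Frobenius degrees, the functor `D₁ → D₂` induced by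
`K₁ ↪ K₂`, and the natural transformations `Φ₁ → Φ₂|_{D₁}`, `B₁ → B₂|_{D₁}`". [cite: MochizukiFrdI2008, Thm. 6.2 (i) p.110]

The tree's named statement `Literature.AlgebraicGeometry.Frobenioids.Thm62i M M₂ βψ φψ`
(`GeometricFrobenioids.lean`, abc-iut-L1-t3; FACT-LIST row F-1103) abstracts `ψ` into a base functor `βψ` and
divisor maps `φψ` and quantifies over DATA-ONLY interfaces `M : GeometricModelFrobenioid Γ C`,
`M₂ : GeometricModelFrobenioid Γ₂ C₂`; its own docstring labels it a SCHEMA "faithful to print only when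
instantiated with THE data induced by `ψ` on the constructed models … not a closed citable fact".  This
PROOF-ONLY file records the kernel fact behind that label: the universal closure over the decl's own binders
(universe levels `0`) is FALSE — with the GENUINE source model `geomModelFrobenioid Γ` (abc-iut-L6-t10) over the
nonempty category `C_{K̃/K}` and a target "model" whose total category is EMPTY (legal data for the interface:
operations with empty base functor, divisor monoids `Φ(L)` themselves), no functor `Ψ : C₁ → C₂` exists at all.

* `Thm62iSchema.not_thm62i_of_isEmpty` — `Thm62i M M₂ βψ φψ` fails whenever `C` has an object and `C₂` is empty;
* `not_forall_thm62i` — the kernel `¬ ∀ …, Thm62i M M₂ βψ φψ` (witness `K = K̃ = K₂ = K̃₂ = ℚ`,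
  `Γ = Γ₂ = GeometricDivisorData.trivial ℚ ℚ`, `C₂ = Discrete PEmpty`).

INSTANCE FORMS (in tree, PROVED — cited, not restated): abc-iut-L6-t10's
`GeometricDivisorData.PullbackDatum.thm62i_of_pullbackDatum` (Thm. 6.2 (i) at the constructed models for EVERY
pull-back datum) and `GeometricDivisorData.Thm62i_frobenius_holds'` / `Thm62i_frobenius_holds` (the Frobenius
datum of Thm. 6.2 (ii)), `GeometricFrobenioidThm62iFunctor.lean`.
FACT-LIST reading (abc-iut cell, R5/R7): row F-1103 = «universal-closure REFUTED (schema over a free target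
model); instance forms PROVED».  Refuted-as-schema is a statement about OUR typing, not about the paper.
No definitions of the tree are touched; nothing here bears on [IUTchIII] Cor. 3.12 or asserts anything about abc.
-/

noncomputable section

namespace Literature.AlgebraicGeometry.Frobenioids

open CategoryTheory Opposite

namespace Thm62iSchema

universe u v

/-- The schema `Thm62i M M₂ βψ φψ` asserts the EXISTENCE of a functor `Ψ : C → C₂`; it therefore fails for every
source interface over a category with an object and every target interface over an empty category, whatever
`βψ`, `φψ` are. [cite: MochizukiFrdI2008, Thm. 6.2 (i) p.110] -/
theorem not_thm62i_of_isEmpty {K : Type} [Field K] {Kt : Type} [Field Kt] [Algebra K Kt]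
    {Γ : GeometricDivisorData K Kt} {C : Type u} [Category.{v} C] (M : GeometricModelFrobenioid Γ C)
    {K₂ : Type} [Field K₂] {Kt₂ : Type} [Field Kt₂] [Algebra K₂ Kt₂] [IsGalois K₂ Kt₂]
    {Γ₂ : GeometricDivisorData K₂ Kt₂} {C₂ : Type u} [Category.{v} C₂] (M₂ : GeometricModelFrobenioid Γ₂ C₂)
    (βψ : FinSubextCat K Kt ⥤ FinSubextCat K₂ Kt₂)
    (φψ : ∀ X : FinSubextCat K Kt, M.ops.Mon X →* M₂.ops.Mon (βψ.obj X))
    (A : C) [IsEmpty C₂] : ¬ Thm62i M M₂ βψ φψ := by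
  rintro ⟨Ψ, -⟩
  exact isEmptyElim (Ψ.obj A)

end Thm62iSchema

/-- **FACT-LIST F-1103, universal closure REFUTED in the kernel**: abc-iut-L1-t3's schema `Thm62i` ([FrdI]
Thm. 6.2 (i) "ψ induces a functor `Ψ : C₁ → C₂` …") over its own binders — data-only source/target interfaces
`M`, `M₂`, free `βψ`, `φψ`, universe levels `0` — is false: source = THE geometric model Frobenioid
`geomModelFrobenioid Γ` over `K = K̃ = ℚ`, `Γ = GeometricDivisorData.trivial ℚ ℚ` (its category contains the
object `(Spec ℚ, 0)`), target = interface data over the EMPTY category `Discrete PEmpty` (empty base functor,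
divisor monoids `Φ(L)`), `βψ = 𝟭`, `φψ = 1`: no functor into the empty category exists.  Instance forms PROVED
in the tree: `GeometricDivisorData.PullbackDatum.thm62i_of_pullbackDatum`, `GeometricDivisorData.Thm62i_frobenius_holds'`.
[cite: MochizukiFrdI2008, Thm. 6.2 (i) p.110] -/
theorem not_forall_thm62i :
    ¬ ∀ (K : Type) [Field K] (Kt : Type) [Field Kt] [Algebra K Kt] [IsGalois K Kt]
        (Γ : GeometricDivisorData K Kt) (C : Type) [Category.{0} C] (M : GeometricModelFrobenioid Γ C)
        (K₂ : Type) [Field K₂] (Kt₂ : Type) [Field Kt₂] [Algebra K₂ Kt₂] [IsGalois K₂ Kt₂]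
        (Γ₂ : GeometricDivisorData K₂ Kt₂) (C₂ : Type) [Category.{0} C₂] (M₂ : GeometricModelFrobenioid Γ₂ C₂)
        (βψ : FinSubextCat K Kt ⥤ FinSubextCat K₂ Kt₂)
        (φψ : ∀ X : FinSubextCat K Kt, M.ops.Mon X →* M₂.ops.Mon (βψ.obj X)),
        Literature.AlgebraicGeometry.Frobenioids.Thm62i M M₂ βψ φψ := by
  intro h
  let Γ : GeometricDivisorData ℚ ℚ := GeometricDivisorData.trivial ℚ ℚ
  -- target "model": interface data over the EMPTY category
  let ops₂ : PreFrobenioidData.{0} (Discrete PEmpty.{1}) (FinSubextCat ℚ ℚ) :=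
    { base := Functor.empty _
      Mon := fun X => Multiplicative (Γ.Phi X)
      pull := fun σ => Γ.pullPhi σ
      pull_id := fun X x => Γ.pullPhi_id X x
      pull_comp := fun β α x => Γ.pullPhi_comp β α x
      div := fun {A} _ => A.as.elim
      degFr := fun {A} _ => A.as.elim
      div_id := fun A => A.as.elim
      div_comp := fun {A} _ _ => A.as.elim
      degFr_id := fun A => A.as.elim
      degFr_comp := fun {A} _ _ => A.as.elim }
  let M₂ : GeometricModelFrobenioid Γ (Discrete PEmpty.{1}) :=
    { ops := ops₂
      monEquiv := fun _ => MulEquiv.refl _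
      monEquiv_natural := fun _ _ => rfl }
  -- an object of the genuine source model `C_{ℚ/ℚ}`: `(Spec ℚ, 0)`
  let A : geomFrobenioid Γ := ⟨⟨⊥⟩, 1⟩
  exact Thm62iSchema.not_thm62i_of_isEmpty (geomModelFrobenioid Γ) M₂ (𝟭 _) (fun _ => 1) A
    (h ℚ ℚ Γ (geomFrobenioid Γ) (geomModelFrobenioid Γ) ℚ ℚ Γ (Discrete PEmpty.{1}) M₂ (𝟭 _) (fun _ => 1))

end Literature.AlgebraicGeometry.Frobenioids

end
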